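import Literature.NumberTheory.ModularForms.InterpolationKernels
import Literature.NumberTheory.ModularForms.LogLambdaGrowth
import HarnessLib

/-!
# The kernel numerators are in `𝓟` and the poles lie on `SL₂(ℤ)`-orbits (CKMRV Theorem 4.1 (1), (4))

Cohn–Kumar–Miller–Radchenko–Viazovska, Ann. of Math. 196 (2022) = arXiv:1902.05438, Theorem 4.1:
(1) "For fixed `z ∈ ℍ` the poles of `𝒦(τ,z)` and `𝒦±(τ,z)` in `τ` are all simple and contained in
the `SL₂(ℤ)`-orbit of `z`"; (4) "The functions `Δ(τ)Δ(z)(j(τ) − j(z))𝒦±^{(8)}(τ,z)` and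
`Δ(τ)Δ(z)²(j(τ) − j(z))𝒦±^{(24)}(τ,z)` are in the class `𝓟` both as functions of `τ` and `z`."
§4.4: "Poles occur in the entries of `Υ±^{(d)}(τ,z)` only from dividing by `j(τ) − j(z)`. Thus, the
poles of these matrix entries in `τ` are contained in the `SL₂(ℤ)`-orbit of `z` … the membership in
`𝓟` asserted in property (4) follows from the formulas by using `jΔ ∈ 𝓟`."

For the explicit kernels of `InterpolationKernels.lean` we PROVE:

* `kernel…_eq_div`: `𝒦 = N/(Δ(τ)Δ(z)^m(j(τ) − j(z)))` (`m = 1` for `d = 8`, `m = 2` for `d = 24`)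
  with explicit numerators `numPlus8`, `numMinus8`, `numPlus24`, `numMinus24` that are polynomials
  in `φⱼ(τ), ψⱼ(τ), φ̃ⱼ(z), ψ̃ⱼ(z), E₄, E₆, Δ` (the identity holds everywhere, both sides being `0` on
  the polar set by the junk convention);
* **(4), first half**: each numerator is in `𝓟` as a function of `τ` and as a function of `z`
  (`isClassP_num…_left/right`), using `φⱼ, E₂ ∈ 𝓟` (`QuasimodularPhi`), `U, V, W ∈ 𝓟`
  (`ModerateGrowthTheta`), `𝓛, 𝓛_S ∈ 𝓟` (`LogLambdaGrowth`), `E₄, E₆, Δ ∈ 𝓟` (`ModerateGrowth`);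
* **(1), location**: the denominator vanishes iff `τ ∈ SL₂(ℤ)·z` (`kernelDenom_eq_zero_iff`, from
  `kleinJ_eq_kleinJ_iff` of `ModularCurveKleinJ.lean`).

The simplicity of the poles, the residues (3) and the bounds (4.14) at `i∞` are not treated here.

## References

* H. Cohn, A. Kumar, S. D. Miller, D. Radchenko, M. Viazovska, Ann. of Math. 196 (2022),
  arXiv:1902.05438, Theorem 4.1 (1), (4); §4.4. [CohnEtAl2019]
-/

noncomputable section

open Complex hiding I
open Filter Topology ModularForm SlashInvariantForm EisensteinSeries
open UpperHalfPlane hiding I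
open Complex (I)
open scoped Real MatrixGroups ModularForm Manifold

namespace Literature.NumberTheory.ModularForms

open Literature.NumberTheory.EllipticCurves.ModularForms (kleinJ kleinJ_smul kleinJ_eq_kleinJ_iff)

/-! ## All building blocks are in `𝓟` -/

/-- `isClassP_E₄` (auxiliary). [folklore] -/
theorem isClassP_E₄ : IsClassP ⇑E₄ := isClassP_E (by norm_num)
/-- `E₆ ∈ 𝓟`. [cite: CohnEtAl2019, §4.1] -/
theorem isClassP_E₆ : IsClassP ⇑E₆ := isClassP_E (by norm_num)
/-- `E₈ ∈ 𝓟`. [cite: CohnEtAl2019, §4.1] -/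
theorem isClassP_E8fun : IsClassP E8fun := isClassP_E₄.mul isClassP_E₄
/-- `E₁₀ ∈ 𝓟`. [cite: CohnEtAl2019, §4.1] -/
theorem isClassP_E10fun : IsClassP E10fun := isClassP_E₄.mul isClassP_E₆
/-- `E₁₄ ∈ 𝓟`. [cite: CohnEtAl2019, §4.1] -/
theorem isClassP_E14fun : IsClassP E14fun := (isClassP_E₄.mul isClassP_E₄).mul isClassP_E₆

/-- `φ̃₋₂ = z² ∈ 𝓟`. [folklore] -/
theorem isClassP_phiTildeNeg2 : IsClassP phiTildeNeg2 := by
  have : phiTildeNeg2 = (fun τ : ℍ => (τ : ℂ)) ^ 2 := by funext τ; simp [phiTildeNeg2]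
  rw [this]; exact isClassP_coe.pow 2

/-- `φ̃₀ ∈ 𝓟`. [folklore] -/
theorem isClassP_phiTilde0 : IsClassP phiTilde0 := by
  have : phiTilde0 = (fun τ : ℍ => (τ : ℂ)) ^ 2 * E2 - (6 * I / π) • fun τ : ℍ => (τ : ℂ) := by
    funext τ; simp [phiTilde0, smul_eq_mul]; ring
  rw [this]
  exact ((isClassP_coe.pow 2).mul isClassP_E2).sub (isClassP_coe.smul _)

/-- `φ̃₂ ∈ 𝓟`. [folklore] -/
theorem isClassP_phiTilde2 : IsClassP phiTilde2 := by
  have : phiTilde2 = ((fun τ : ℍ => (τ : ℂ)) * E2 - fun _ => 6 * I / π) ^ 2 := by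
    funext τ; simp [phiTilde2]
  rw [this]
  exact ((isClassP_coe.mul isClassP_E2).sub (isClassP_const _)).pow 2

/-- `ξ₂, ξ₄, ξ₂|S, ξ₄|S ∈ 𝓟`. [folklore] -/
theorem isClassP_xi2 : IsClassP xi2 := isClassP_thetaU.add isClassP_thetaW
/-- `ξ₂|S ∈ 𝓟`. [cite: CohnEtAl2019, §4.2] -/
theorem isClassP_xi2S : IsClassP xi2S := (isClassP_thetaU.add isClassP_thetaV).neg
/-- `ξ₄ ∈ 𝓟`. [cite: CohnEtAl2019, §4.2] -/
theorem isClassP_xi4 : IsClassP xi4 :=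
  ((isClassP_thetaU.mul isClassP_thetaU).add (isClassP_thetaW.mul isClassP_thetaW)).sub
    ((isClassP_thetaV.mul isClassP_thetaV).smul 2)
/-- `ξ₄|S ∈ 𝓟`. [cite: CohnEtAl2019, §4.2] -/
theorem isClassP_xi4S : IsClassP xi4S :=
  ((isClassP_thetaU.mul isClassP_thetaU).add (isClassP_thetaV.mul isClassP_thetaV)).sub
    ((isClassP_thetaW.mul isClassP_thetaW).smul 2)

/-- **`ψ₂ ∈ 𝓟`** (needs `𝓛, 𝓛_S ∈ 𝓟`). [cite: CohnEtAl2019, §4.2 Proposition 4.3] -/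
theorem isClassP_psi2 : IsClassP psi2 :=
  (isClassP_xi2.mul isClassP_logLambda).add (isClassP_xi2S.mul isClassP_logLambdaS)

/-- **`ψ₄ ∈ 𝓟`.** [cite: CohnEtAl2019, §4.2 Proposition 4.3] -/
theorem isClassP_psi4 : IsClassP psi4 :=
  (isClassP_xi4.mul isClassP_logLambda).add (isClassP_xi4S.mul isClassP_logLambdaS)

/-- `ψ̃₀ = 𝓛`, `ψ̃₂ = W`, `ψ̃₄ = U² − V² ∈ 𝓟`. [cite: CohnEtAl2019, §4.2 Proposition 4.5] -/
theorem isClassP_psiTilde : IsClassP psiTilde0 ∧ IsClassP psiTilde2 ∧ IsClassP psiTilde4 :=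
  ⟨isClassP_logLambda, isClassP_thetaW,
    (isClassP_thetaU.mul isClassP_thetaU).sub (isClassP_thetaV.mul isClassP_thetaV)⟩

/-- The resultant `R(τ,z) = E₄(τ)³Δ(z) − E₄(z)³Δ(τ) = Δ(τ)Δ(z)(j(τ) − j(z))`. [folklore] -/
def jResultant (τ z : ℍ) : ℂ := E₄ τ ^ 3 * ModularForm.discriminant z - E₄ z ^ 3 * ModularForm.discriminant τ

/-- `R = Δ(τ)Δ(z)(j(τ) − j(z))`. [folklore] -/
theorem jResultant_eq (τ z : ℍ) :
    jResultant τ z = ModularForm.discriminant τ * ModularForm.discriminant z * (kleinJ τ - kleinJ z) := by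
  have h1 := ModularForm.discriminant_ne_zero τ
  have h2 := ModularForm.discriminant_ne_zero z
  simp only [jResultant, kleinJ]
  field_simp

/-- `R(·, z) ∈ 𝓟`. [folklore] -/
theorem isClassP_jResultant_left (z : ℍ) : IsClassP fun τ => jResultant τ z := by
  have : (fun τ => jResultant τ z) = (⇑E₄) ^ 3 * (fun _ => ModularForm.discriminant z) -
      (E₄ z ^ 3) • ModularForm.discriminant := by
    funext τ; simp [jResultant, smul_eq_mul]
  rw [this]
  exact ((isClassP_E₄.pow 3).mul (isClassP_const _)).sub (isClassP_discriminant.smul _)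

/-- `R(τ, ·) ∈ 𝓟`. [folklore] -/
theorem isClassP_jResultant_right (τ : ℍ) : IsClassP fun z => jResultant τ z := by
  have : (fun z => jResultant τ z) = (E₄ τ ^ 3) • ModularForm.discriminant -
      (⇑E₄) ^ 3 * fun _ => ModularForm.discriminant τ := by
    funext z; simp [jResultant, smul_eq_mul]
  rw [this]
  exact (isClassP_discriminant.smul _).sub ((isClassP_E₄.pow 3).mul (isClassP_const _))

/-! ## The polar set -/

/-- **Theorem 4.1 (1), location of the poles**: `Δ(τ)Δ(z)(j(τ) − j(z)) = 0` iff `τ ∈ SL₂(ℤ)·z`.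
[cite: CohnEtAl2019, Theorem 4.1 (1)] -/
theorem kernelDenom_eq_zero_iff (τ z : ℍ) :
    ModularForm.discriminant τ * ModularForm.discriminant z * (kleinJ τ - kleinJ z) = 0 ↔
      ∃ γ : SL(2, ℤ), γ • z = τ := by
  rw [mul_eq_zero, mul_eq_zero, sub_eq_zero, or_iff_right, eq_comm, kleinJ_eq_kleinJ_iff]
  exact not_or_intro (ModularForm.discriminant_ne_zero τ) (ModularForm.discriminant_ne_zero z)

/-! ## Numerators: dimension `8` -/

/-- The numerator `N₊^{(8)} = Δ(τ)Δ(z)(j(τ)−j(z))𝒦₊^{(8)}`: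
`π²/(36i)·[φ₋₂E₆(τ)(R φ̃₋₂(z) + Δ(τ)E₈(z)φ̃₂(z)) + φ₀E₄(τ)(−2Rφ̃₋₂(z) − 2Δ(τ)E₁₀(z)φ̃₀(z))`
` + φ₂(τ)E₁₄(τ)Δ(z)φ̃₋₂(z)]`, `R = E₄(τ)³Δ(z) − E₄(z)³Δ(τ)`. [cite: CohnEtAl2019, Theorem 4.1 (4)] -/
def numPlus8 (τ z : ℍ) : ℂ :=
  (π : ℂ) ^ 2 / (36 * I) *
    (phiNeg2 τ * E₆ τ * (jResultant τ z * phiTildeNeg2 z + ModularForm.discriminant τ * E8fun z * phiTilde2 z) +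
      phi0 τ * E₄ τ * (-2 * jResultant τ z * phiTildeNeg2 z -
        2 * ModularForm.discriminant τ * E10fun z * phiTilde0 z) +
      phi2 τ * E14fun τ * ModularForm.discriminant z * phiTildeNeg2 z)

/-- `𝒦₊^{(8)} = N₊^{(8)}/(Δ(τ)Δ(z)(j(τ)−j(z)))` everywhere. [cite: CohnEtAl2019, Theorem 4.1 (4)] -/
theorem kernelPlus8_eq_div (τ z : ℍ) :
    kernelPlus8 τ z = numPlus8 τ z /
      (ModularForm.discriminant τ * ModularForm.discriminant z * (kleinJ τ - kleinJ z)) := by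
  have h1 := ModularForm.discriminant_ne_zero τ
  have h2 := ModularForm.discriminant_ne_zero z
  by_cases hJ : kleinJ τ - kleinJ z = 0
  · simp [kernelPlus8, hJ]
  · rw [numPlus8, jResultant_eq]
    simp only [kernelPlus8, f2fun, E14fun, E8fun, E10fun, Pi.mul_apply, Pi.inv_apply]
    field_simp

/-- `N₊^{(8)}(·, z) ∈ 𝓟`. [cite: CohnEtAl2019, Theorem 4.1 (4)] -/
theorem isClassP_numPlus8_left (z : ℍ) : IsClassP fun τ => numPlus8 τ z := by
  have : (fun τ => numPlus8 τ z) = ((π : ℂ) ^ 2 / (36 * I)) •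
      (phiNeg2 * ⇑E₆ * ((phiTildeNeg2 z) • (fun τ => jResultant τ z) + (E8fun z * phiTilde2 z) • ModularForm.discriminant) +
        phi0 * ⇑E₄ * ((-2 * phiTildeNeg2 z) • (fun τ => jResultant τ z) -
          (2 * E10fun z * phiTilde0 z) • ModularForm.discriminant) +
        (ModularForm.discriminant z * phiTildeNeg2 z) • (phi2 * E14fun)) := by
    funext τ; simp [numPlus8, smul_eq_mul]; ring
  rw [this]
  refine IsClassP.smul ?_ _
  refine ((((isClassP_phiNeg2.mul isClassP_E₆).mul (((isClassP_jResultant_left z).smul _).add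
    (isClassP_discriminant.smul _))).add ((isClassP_phi0.mul isClassP_E₄).mul
    (((isClassP_jResultant_left z).smul _).sub (isClassP_discriminant.smul _)))).add
    ((isClassP_phi2.mul isClassP_E14fun).smul _))

/-- `N₊^{(8)}(τ, ·) ∈ 𝓟`. [cite: CohnEtAl2019, Theorem 4.1 (4)] -/
theorem isClassP_numPlus8_right (τ : ℍ) : IsClassP fun z => numPlus8 τ z := by
  have : (fun z => numPlus8 τ z) = ((π : ℂ) ^ 2 / (36 * I)) •
      ((phiNeg2 τ * E₆ τ) • ((fun z => jResultant τ z) * phiTildeNeg2 +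
          (ModularForm.discriminant τ) • (E8fun * phiTilde2)) +
        (phi0 τ * E₄ τ) • ((-2 : ℂ) • ((fun z => jResultant τ z) * phiTildeNeg2) -
          (2 * ModularForm.discriminant τ) • (E10fun * phiTilde0)) +
        (phi2 τ * E14fun τ) • (ModularForm.discriminant * phiTildeNeg2)) := by
    funext z; simp [numPlus8, smul_eq_mul]; ring
  rw [this]
  refine IsClassP.smul ?_ _
  refine (((((isClassP_jResultant_right τ).mul isClassP_phiTildeNeg2).add
    ((isClassP_E8fun.mul isClassP_phiTilde2).smul _)).smul _).add
    (((((isClassP_jResultant_right τ).mul isClassP_phiTildeNeg2).smul _).sub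
      ((isClassP_E10fun.mul isClassP_phiTilde0).smul _)).smul _)).add
    ((isClassP_discriminant.mul isClassP_phiTildeNeg2).smul _)

/-- The numerator `N₋^{(8)} = Δ(τ)Δ(z)(j(τ)−j(z))𝒦₋^{(8)}`:
`(2𝔠π)⁻¹·[Δ(τ)E₄(τ)(−2𝔠)E₁₀(z)ψ̃₀(z) + ψ₂(τ)E₁₄(τ)(E₈(z)ψ̃₂(z) − E₆(z)ψ̃₄(z))`
` + ψ₄(τ)((𝔠Δ(τ) − E₄(τ)³)E₈(z)ψ̃₂(z) + E₄(τ)³E₆(z)ψ̃₄(z))]` (`j(τ)Δ(τ) = E₄(τ)³`).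
[cite: CohnEtAl2019, Theorem 4.1 (4)] -/
def numMinus8 (τ z : ℍ) : ℂ :=
  1 / (2 * 1728 * (π : ℂ)) *
    (ModularForm.discriminant τ * E₄ τ * (-2 * 1728 * E10fun z * psiTilde0 z) +
      psi2 τ * E14fun τ * (E8fun z * psiTilde2 z - E₆ z * psiTilde4 z) +
      psi4 τ * ((1728 * ModularForm.discriminant τ - E₄ τ ^ 3) * E8fun z * psiTilde2 z +
        E₄ τ ^ 3 * E₆ z * psiTilde4 z))

/-- `𝒦₋^{(8)} = N₋^{(8)}/(Δ(τ)Δ(z)(j(τ)−j(z)))` everywhere. [cite: CohnEtAl2019, Theorem 4.1 (4)] -/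
theorem kernelMinus8_eq_div (τ z : ℍ) :
    kernelMinus8 τ z = numMinus8 τ z /
      (ModularForm.discriminant τ * ModularForm.discriminant z * (kleinJ τ - kleinJ z)) := by
  have h1 := ModularForm.discriminant_ne_zero τ
  have h2 := ModularForm.discriminant_ne_zero z
  by_cases hJ : kleinJ τ - kleinJ z = 0
  · simp [kernelMinus8, hJ]
  · have hj : kleinJ τ = E₄ τ ^ 3 / ModularForm.discriminant τ := rfl
    rw [numMinus8]
    simp only [kernelMinus8, f2fun, E14fun, E8fun, E10fun, Pi.mul_apply, Pi.inv_apply]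
    rw [hj] at hJ ⊢
    field_simp

/-- `N₋^{(8)}(·, z) ∈ 𝓟`. [cite: CohnEtAl2019, Theorem 4.1 (4)] -/
theorem isClassP_numMinus8_left (z : ℍ) : IsClassP fun τ => numMinus8 τ z := by
  have : (fun τ => numMinus8 τ z) = (1 / (2 * 1728 * (π : ℂ))) •
      ((-2 * 1728 * E10fun z * psiTilde0 z) • (ModularForm.discriminant * ⇑E₄) +
        (E8fun z * psiTilde2 z - E₆ z * psiTilde4 z) • (psi2 * E14fun) +
        psi4 * ((E8fun z * psiTilde2 z) • ((1728 : ℂ) • ModularForm.discriminant - (⇑E₄) ^ 3) +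
          (E₆ z * psiTilde4 z) • (⇑E₄) ^ 3)) := by
    funext τ; simp [numMinus8, smul_eq_mul]; ring
  rw [this]
  refine IsClassP.smul ?_ _
  exact (((isClassP_discriminant.mul isClassP_E₄).smul _).add ((isClassP_psi2.mul isClassP_E14fun).smul _)).add
    (isClassP_psi4.mul ((((isClassP_discriminant.smul _).sub (isClassP_E₄.pow 3)).smul _).add
      ((isClassP_E₄.pow 3).smul _)))

/-- `N₋^{(8)}(τ, ·) ∈ 𝓟`. [cite: CohnEtAl2019, Theorem 4.1 (4)] -/
theorem isClassP_numMinus8_right (τ : ℍ) : IsClassP fun z => numMinus8 τ z := by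
  obtain ⟨hT0, hT2, hT4⟩ := isClassP_psiTilde
  have : (fun z => numMinus8 τ z) = (1 / (2 * 1728 * (π : ℂ))) •
      ((ModularForm.discriminant τ * E₄ τ * (-2 * 1728)) • (E10fun * psiTilde0) +
        (psi2 τ * E14fun τ) • (E8fun * psiTilde2 - ⇑E₆ * psiTilde4) +
        (psi4 τ * (1728 * ModularForm.discriminant τ - E₄ τ ^ 3)) • (E8fun * psiTilde2) +
        (psi4 τ * E₄ τ ^ 3) • (⇑E₆ * psiTilde4)) := by
    funext z; simp [numMinus8, smul_eq_mul]; ring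
  rw [this]
  refine IsClassP.smul ?_ _
  exact ((((isClassP_E10fun.mul hT0).smul _).add (((isClassP_E8fun.mul hT2).sub
    (isClassP_E₆.mul hT4)).smul _)).add ((isClassP_E8fun.mul hT2).smul _)).add
    ((isClassP_E₆.mul hT4).smul _)

/-! ## Numerators: dimension `24` -/

/-- The numerator `N₊^{(24)} = Δ(τ)Δ(z)²(j(τ)−j(z))𝒦₊^{(24)}`:
`π²/(36𝔠i)·[φ₋₂E₁₄(τ)(6RE₄(z)φ̃₋₂ + (𝔠Δ(τ)Δ(z) − 6R)φ̃₂) + φ₀(τ)((−12E₄(τ)³ + 5𝔠Δ(τ))RE₄(z)φ̃₋₂`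
` − 2𝔠Δ(τ)²E₁₄(z)φ̃₀ + (12E₄(τ)³ − 7𝔠Δ(τ))Rφ̃₂) + φ₂E₁₀(τ)((𝔠Δ(τ)Δ(z) + 6R)E₄(z)φ̃₋₂ − 6Rφ̃₂)]`
(`R = E₄(τ)³Δ(z) − E₄(z)³Δ(τ)`, `j(τ)Δ(τ) = E₄(τ)³`). [cite: CohnEtAl2019, Theorem 4.1 (4)] -/
def numPlus24 (τ z : ℍ) : ℂ :=
  (π : ℂ) ^ 2 / (36 * 1728 * I) *
    (phiNeg2 τ * E14fun τ * (6 * jResultant τ z * E₄ z * phiTildeNeg2 z +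
        (1728 * ModularForm.discriminant τ * ModularForm.discriminant z - 6 * jResultant τ z) * phiTilde2 z) +
      phi0 τ * ((-12 * E₄ τ ^ 3 + 5 * 1728 * ModularForm.discriminant τ) * jResultant τ z * E₄ z * phiTildeNeg2 z -
        2 * 1728 * ModularForm.discriminant τ ^ 2 * E14fun z * phiTilde0 z +
        (12 * E₄ τ ^ 3 - 7 * 1728 * ModularForm.discriminant τ) * jResultant τ z * phiTilde2 z) +
      phi2 τ * E10fun τ * ((1728 * ModularForm.discriminant τ * ModularForm.discriminant z + 6 * jResultant τ z) *
        E₄ z * phiTildeNeg2 z - 6 * jResultant τ z * phiTilde2 z))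

/-- `𝒦₊^{(24)} = N₊^{(24)}/(Δ(τ)Δ(z)²(j(τ)−j(z)))` everywhere. [cite: CohnEtAl2019, Theorem 4.1 (4)] -/
theorem kernelPlus24_eq_div (τ z : ℍ) :
    kernelPlus24 τ z = numPlus24 τ z /
      (ModularForm.discriminant τ * ModularForm.discriminant z ^ 2 * (kleinJ τ - kleinJ z)) := by
  have h1 := ModularForm.discriminant_ne_zero τ
  have h2 := ModularForm.discriminant_ne_zero z
  by_cases hJ : kleinJ τ - kleinJ z = 0
  · simp [kernelPlus24, hJ]
  · have hj : kleinJ τ = E₄ τ ^ 3 / ModularForm.discriminant τ := rfl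
    have hjz : kleinJ z = E₄ z ^ 3 / ModularForm.discriminant z := rfl
    rw [numPlus24, jResultant_eq]
    simp only [kernelPlus24, f2fun, E14fun, E10fun, Pi.mul_apply, Pi.inv_apply]
    rw [hj, hjz] at hJ ⊢
    field_simp

/-- `N₊^{(24)}(·, z) ∈ 𝓟`. [cite: CohnEtAl2019, Theorem 4.1 (4)] -/
theorem isClassP_numPlus24_left (z : ℍ) : IsClassP fun τ => numPlus24 τ z := by
  have hR := isClassP_jResultant_left z
  have : (fun τ => numPlus24 τ z) = ((π : ℂ) ^ 2 / (36 * 1728 * I)) •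
      (phiNeg2 * E14fun * ((6 * E₄ z * phiTildeNeg2 z) • (fun τ => jResultant τ z) +
          (phiTilde2 z) • ((1728 * ModularForm.discriminant z) • ModularForm.discriminant -
            (6 : ℂ) • fun τ => jResultant τ z)) +
        phi0 * ((E₄ z * phiTildeNeg2 z) • (((-12 : ℂ) • (⇑E₄) ^ 3 + (5 * 1728 : ℂ) • ModularForm.discriminant) *
            fun τ => jResultant τ z) -
          (2 * 1728 * E14fun z * phiTilde0 z) • ModularForm.discriminant ^ 2 +
          (phiTilde2 z) • (((12 : ℂ) • (⇑E₄) ^ 3 - (7 * 1728 : ℂ) • ModularForm.discriminant) *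
            fun τ => jResultant τ z)) +
        phi2 * E10fun * ((E₄ z * phiTildeNeg2 z) • ((1728 * ModularForm.discriminant z) • ModularForm.discriminant +
            (6 : ℂ) • fun τ => jResultant τ z) - (6 * phiTilde2 z) • fun τ => jResultant τ z)) := by
    funext τ; simp [numPlus24, smul_eq_mul]; ring
  rw [this]
  refine IsClassP.smul ?_ _
  refine (((isClassP_phiNeg2.mul isClassP_E14fun).mul ((hR.smul _).add
    (((isClassP_discriminant.smul _).sub (hR.smul _)).smul _))).add
    (isClassP_phi0.mul ((((((isClassP_E₄.pow 3).smul _).add (isClassP_discriminant.smul _)).mul hR).smul _).sub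
      ((isClassP_discriminant.pow 2).smul _) |>.add
      (((((isClassP_E₄.pow 3).smul _).sub (isClassP_discriminant.smul _)).mul hR).smul _)))).add
    ((isClassP_phi2.mul isClassP_E10fun).mul ((((isClassP_discriminant.smul _).add (hR.smul _)).smul _).sub
      (hR.smul _)))

/-- `N₊^{(24)}(τ, ·) ∈ 𝓟`. [cite: CohnEtAl2019, Theorem 4.1 (4)] -/
theorem isClassP_numPlus24_right (τ : ℍ) : IsClassP fun z => numPlus24 τ z := by
  have hR := isClassP_jResultant_right τ
  have : (fun z => numPlus24 τ z) = ((π : ℂ) ^ 2 / (36 * 1728 * I)) •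
      ((phiNeg2 τ * E14fun τ) • ((6 : ℂ) • ((fun z => jResultant τ z) * ⇑E₄ * phiTildeNeg2) +
          ((1728 * ModularForm.discriminant τ) • ModularForm.discriminant - (6 : ℂ) • fun z => jResultant τ z) *
            phiTilde2) +
        (phi0 τ) • ((-12 * E₄ τ ^ 3 + 5 * 1728 * ModularForm.discriminant τ) •
            ((fun z => jResultant τ z) * ⇑E₄ * phiTildeNeg2) -
          (2 * 1728 * ModularForm.discriminant τ ^ 2) • (E14fun * phiTilde0) +
          (12 * E₄ τ ^ 3 - 7 * 1728 * ModularForm.discriminant τ) • ((fun z => jResultant τ z) * phiTilde2)) +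
        (phi2 τ * E10fun τ) • ((((1728 * ModularForm.discriminant τ) • ModularForm.discriminant +
            (6 : ℂ) • fun z => jResultant τ z) * ⇑E₄ * phiTildeNeg2) -
          (6 : ℂ) • ((fun z => jResultant τ z) * phiTilde2))) := by
    funext z; simp [numPlus24, smul_eq_mul]; ring
  rw [this]
  refine IsClassP.smul ?_ _
  refine (((((hR.mul isClassP_E₄).mul isClassP_phiTildeNeg2).smul _).add
    (((isClassP_discriminant.smul _).sub (hR.smul _)).mul isClassP_phiTilde2)).smul _ |>.add
    ((((((hR.mul isClassP_E₄).mul isClassP_phiTildeNeg2).smul _).sub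
      ((isClassP_E14fun.mul isClassP_phiTilde0).smul _)).add ((hR.mul isClassP_phiTilde2).smul _)).smul _)).add
    ((((((isClassP_discriminant.smul _).add (hR.smul _)).mul isClassP_E₄).mul isClassP_phiTildeNeg2).sub
      ((hR.mul isClassP_phiTilde2).smul _)).smul _)

/-- The numerator `N₋^{(24)} = Δ(τ)Δ(z)²(j(τ)−j(z))𝒦₋^{(24)}`:
`(2𝔠π)⁻¹·[−2𝔠Δ(τ)²E₁₄(z)ψ̃₀ − 2𝔠Δ(τ)Rψ̃₂ + ψ₂E₁₀(τ)((E₄(τ)³Δ(z) + 2R)ψ̃₂ − Δ(τ)E₁₀(z)ψ̃₄)`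
` + ψ₄E₈(τ)((𝔠Δ(τ)Δ(z) − 2R − E₄(τ)³Δ(z))ψ̃₂ + Δ(τ)E₁₀(z)ψ̃₄)]`. [cite: CohnEtAl2019, Theorem 4.1 (4)] -/
def numMinus24 (τ z : ℍ) : ℂ :=
  1 / (2 * 1728 * (π : ℂ)) *
    (-2 * 1728 * ModularForm.discriminant τ ^ 2 * E14fun z * psiTilde0 z -
        2 * 1728 * ModularForm.discriminant τ * jResultant τ z * psiTilde2 z +
      psi2 τ * E10fun τ * ((E₄ τ ^ 3 * ModularForm.discriminant z + 2 * jResultant τ z) * psiTilde2 z -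
        ModularForm.discriminant τ * E10fun z * psiTilde4 z) +
      psi4 τ * E8fun τ * ((1728 * ModularForm.discriminant τ * ModularForm.discriminant z - 2 * jResultant τ z -
        E₄ τ ^ 3 * ModularForm.discriminant z) * psiTilde2 z + ModularForm.discriminant τ * E10fun z * psiTilde4 z))

/-- `𝒦₋^{(24)} = N₋^{(24)}/(Δ(τ)Δ(z)²(j(τ)−j(z)))` everywhere. [cite: CohnEtAl2019, Theorem 4.1 (4)] -/
theorem kernelMinus24_eq_div (τ z : ℍ) :
    kernelMinus24 τ z = numMinus24 τ z /
      (ModularForm.discriminant τ * ModularForm.discriminant z ^ 2 * (kleinJ τ - kleinJ z)) := by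
  have h1 := ModularForm.discriminant_ne_zero τ
  have h2 := ModularForm.discriminant_ne_zero z
  by_cases hJ : kleinJ τ - kleinJ z = 0
  · simp [kernelMinus24, hJ]
  · have hj : kleinJ τ = E₄ τ ^ 3 / ModularForm.discriminant τ := rfl
    have hjz : kleinJ z = E₄ z ^ 3 / ModularForm.discriminant z := rfl
    rw [numMinus24, jResultant_eq]
    simp only [kernelMinus24, f2fun, fNeg2fun, E14fun, E10fun, E8fun, Pi.mul_apply, Pi.inv_apply]
    rw [hj, hjz] at hJ ⊢
    field_simp

/-- `N₋^{(24)}(·, z) ∈ 𝓟`. [cite: CohnEtAl2019, Theorem 4.1 (4)] -/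
theorem isClassP_numMinus24_left (z : ℍ) : IsClassP fun τ => numMinus24 τ z := by
  have hR := isClassP_jResultant_left z
  have : (fun τ => numMinus24 τ z) = (1 / (2 * 1728 * (π : ℂ))) •
      ((-2 * 1728 * E14fun z * psiTilde0 z) • ModularForm.discriminant ^ 2 -
        (2 * 1728 * psiTilde2 z) • (ModularForm.discriminant * fun τ => jResultant τ z) +
        psi2 * E10fun * ((psiTilde2 z) • ((ModularForm.discriminant z) • (⇑E₄) ^ 3 + (2 : ℂ) • fun τ => jResultant τ z) -
          (E10fun z * psiTilde4 z) • ModularForm.discriminant) +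
        psi4 * E8fun * ((psiTilde2 z) • ((1728 * ModularForm.discriminant z) • ModularForm.discriminant -
            (2 : ℂ) • (fun τ => jResultant τ z) - (ModularForm.discriminant z) • (⇑E₄) ^ 3) +
          (E10fun z * psiTilde4 z) • ModularForm.discriminant)) := by
    funext τ; simp [numMinus24, smul_eq_mul]; ring
  rw [this]
  refine IsClassP.smul ?_ _
  refine ((((isClassP_discriminant.pow 2).smul _).sub ((isClassP_discriminant.mul hR).smul _)).add
    ((isClassP_psi2.mul isClassP_E10fun).mul (((((isClassP_E₄.pow 3).smul _).add (hR.smul _)).smul _).sub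
      (isClassP_discriminant.smul _)))).add
    ((isClassP_psi4.mul isClassP_E8fun).mul (((((isClassP_discriminant.smul _).sub (hR.smul _)).sub
      ((isClassP_E₄.pow 3).smul _)).smul _).add (isClassP_discriminant.smul _)))

/-- `N₋^{(24)}(τ, ·) ∈ 𝓟`. [cite: CohnEtAl2019, Theorem 4.1 (4)] -/
theorem isClassP_numMinus24_right (τ : ℍ) : IsClassP fun z => numMinus24 τ z := by
  obtain ⟨hT0, hT2, hT4⟩ := isClassP_psiTilde
  have hR := isClassP_jResultant_right τ
  have : (fun z => numMinus24 τ z) = (1 / (2 * 1728 * (π : ℂ))) •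
      ((-2 * 1728 * ModularForm.discriminant τ ^ 2) • (E14fun * psiTilde0) -
        (2 * 1728 * ModularForm.discriminant τ) • ((fun z => jResultant τ z) * psiTilde2) +
        (psi2 τ * E10fun τ) • (((E₄ τ ^ 3) • ModularForm.discriminant + (2 : ℂ) • fun z => jResultant τ z) * psiTilde2 -
          (ModularForm.discriminant τ) • (E10fun * psiTilde4)) +
        (psi4 τ * E8fun τ) • (((1728 * ModularForm.discriminant τ) • ModularForm.discriminant -
            (2 : ℂ) • (fun z => jResultant τ z) - (E₄ τ ^ 3) • ModularForm.discriminant) * psiTilde2 +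
          (ModularForm.discriminant τ) • (E10fun * psiTilde4))) := by
    funext z; simp [numMinus24, smul_eq_mul]; ring
  rw [this]
  refine IsClassP.smul ?_ _
  refine ((((isClassP_E14fun.mul hT0).smul _).sub ((hR.mul hT2).smul _)).add
    (((((isClassP_discriminant.smul _).add (hR.smul _)).mul hT2).sub ((isClassP_E10fun.mul hT4).smul _)).smul
      _)).add
    ((((((isClassP_discriminant.smul _).sub (hR.smul _)).sub (isClassP_discriminant.smul _)).mul hT2).add
      ((isClassP_E10fun.mul hT4).smul _)).smul _)

end Literature.NumberTheory.ModularForms
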